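import Summits.QuantumFields.YangMills.Theorems.FluctuationComparisonRegPrIntLS2BetaCornerInTube
import HarnessLib

/-!
# S2β · DET-REP (B) — THE DOCKING THEOREM OF THE EDGE THIRD: the body of `def DetRepB` TOKEN FOR TOKEN from ONE corner-form row «DET-REP (B)♭»
# (tube + four corner minimisers on its slice modulo the group + the two value rows ON CORNER OBJECTS)

Cell `ym3-torus` (rung R3: continuum `SU(2)` Yang–Mills on `T³` — NOT `d = 4`, NOT infinite volume, NOT a mass gap, NOT Clay); seat
`ymfull-r3-prover-4` g0 (R590-ym (a) item (4), DET-REP (B)); definition-free helper of the crux `stmt-QuantumFields-20520`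
(`--supports … --as helper`, NOT a proof of it and NOT a proof of any registered stub).  Registry of record:
`Cruxes/FluctuationComparisonRegPrIntL/Lines/semiclassical_s2beta.lean` v11.4 sha16 3732b7dff0e7789b, `def DetRepB` :1072–1098 (`stub_detRepB` :1407).
LOCATE of record: HOME `ymfull-r3-prover-4/g0/LOCATE-DETREPB-EDGES-r3p4g0.md` (20520 evidence #51), §G3(b) CORRECTED by `FINDING-QTUBE-KINEMATIC-r3p4g0.md`
((Q-TUBE) is kinematic: WINDOW-ID∕COVER down px21's chart chain + two-data small-field closeness; NO background-response decay on the EDGE third).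

WHAT.  ★★★ `detRepB_text_of_flat` — hypothesis **DET-REP (B)♭** := the PREFIX of `def DetRepB` VERBATIM (`∀ L ∃ c₀ … ∀ F γ J K hJK c`, the `ChartRows`∕`ChartRowsJ`
hypotheses INLINED, `∀ b b′ U V W Z` interior quadrilateral with the four agreements), then per quadrilateral
`∃ dZ dV e σ UZ UV jZ jV ρ (uU uV uW uZ) (kU kV kW kZ) (yU yV yW yZ), ⟨TubeRows body⟩ ∧ ⟨u_X ∈ argminHist X unfolded⟩×4 ∧ ⟨(Q-TUBE)_X : pivotAct ι k_X (σ y_X) = u_X ∧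
y_X ∈ UV ∧ 0 < jV y_X⟩×4 ∧ DETN♭ ∧ JACW♭`, where the two VALUE ROWS are read on CORNER OBJECTS: DETN♭ = the 4-point of `log det M_X − 2·log jV y_X` with `M_X` the slice-Hessian
matrix (the body of the line's `hessStd`) of `q ↦ A(c.Φ(X, σ q.2))` at `((s_X : ℝ), y_X)` (`s_U = s_W = 0`, `s_V = s_Z = 1` — the dummy path variable of the line's letters;
✓`…S2BetaBoundPeano.fderiv_fderiv_slice_eq` turns each into the plain `y`-Hessian under the `C²` row), JACW♭ = the 4-point of `log c.jac (X, σ y_X)`; same amplitudes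
`2·Cst·θBal_J²·e^{−(θ−θ₂)·tdist}` ∕ `Cst·…`.  CONCLUSION = the body of `def DetRepB` with the bodies of `ChartRows`, `ChartRowsJ`, `TubeRows`, `EdgeRows` (×2) and `hessStd` (×4)
INLINED token for token (δ-unfoldable: the Lines-side `theorem stub_detRepB : DetRepB := detRepB_text_of_flat ‹DET-REP (B)♭›` elaborates by unfolding, as ✓`chartSmooth` did).
PROOF = thread the identical prefix; per quadrilateral take `I := Iio ½ ∪ Ioi ½`, the LOCALLY CONSTANT edges `x₀ := (U ∣ V)`, `y₀ := (y_U ∣ y_V)`, `x₁ := (W ∣ Z)`,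
`y₁ := (y_W ∣ y_Z)`; (E0) and both `EdgeRows` bodies by ✓`…S2BetaCornerInTube.edgeRows_text_twoCorners_of_pivotAct_eq` (p784096) from (Q-TUBE) and the `ChartRows` clauses
(2)(7)(10)(12); DETN by the C²-free corner form of the named matrices (`sliceHessMatrix_twoCorner`, = ✓`…S2BetaTwoCornerEdge.sliceHessEntry_of_locallyConst` entrywise);
JACW by `if_pos`∕`if_neg` at `s = 0, 1`.
So DET-REP (B) ⟸ DET-REP (B)♭: the PATH∕EDGE apparatus of the organ carries no content beyond the four corners; what a hand owes is, per interior quadrilateral, the tube of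
record (✓`exists_tubeRows_framed`), EXW∘-existence of the four minimisers, (Q-TUBE)×4 (kinematic: COVER + CLOSE, px21 g17 ∕ ymfull-r3-prover-3 lineages; the base corner is
`k = 1, y = 0`), and the two VALUE ROWS on corner objects — DETN♭ ([Balaban1985UV3] (36)–(37) + [Balaban1984PropagatorsII] (1.33), px21 g17's B1–B4) and JACW♭ ((J-LIP)∘(J-BRD)).

HONEST SCOPE.  Quantifier bookkeeping over landed letters; def-free; default heartbeats; proves nothing of DET-REP (B)♭'s rows, DET-REP (B), GAP♯, S2β or the crux 20520;
finite-volume∕conditional programme; `YM3TorusSU2` NOT proved; rung R3 = SU(2) YM₃ on T³ — NOT d = 4, NOT infinite volume, NOT a mass gap, NOT Clay; the Yang–Mills mass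
gap is NOT proved.

References: [Balaban1985Variational] CMP 102 (1985) Thm 1 (8)–(10) p. 279, (142) p. 299; [Balaban1984PropagatorsII] CMP 96 (1984) (1.33); [Balaban1985UV3] CMP 102 (1985)
(36)–(37) p. 265; [Helgason2000] Ch. I §1 Thm 1.14 p. 96; [Dieudonne1960] Ch. X §2 (10.2.1)–(10.2.3).
-/

noncomputable section

open MeasureTheory Filter Topology Set Function Metric
open scoped ContDiff Matrix.Norms.L2Operator Pointwise
open Literature.MathematicalPhysics.QuantumFieldTheory.Balaban1983to89
open Literature.MathematicalPhysics.QuantumFieldTheory.Balaban1983to89.T3ContinuumYM3Torus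
open Literature.MathematicalPhysics.QuantumFieldTheory.Balaban1983to89.T3NestedUnitLaws
open Literature.MathematicalPhysics.QuantumFieldTheory.Balaban1983to89.T3UnitLawDensityEML
open Literature.MathematicalPhysics.QuantumFieldTheory.Balaban1983to89.T3UnitScaleTilt
open Literature.MathematicalPhysics.QuantumFieldTheory.Balaban1983to89.T3TiltDescent
open Literature.MathematicalPhysics.QuantumFieldTheory.Balaban1983to89.T3PrintedRegularMinimiser
open Literature.MathematicalPhysics.QuantumFieldTheory.Balaban1983to89.T3ConstrainedMinimiser (fibre)
open Literature.MathematicalPhysics.QuantumFieldTheory.Balaban1983to89.T3LevelShift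
open Literature.MathematicalPhysics.QuantumFieldTheory.Balaban1983to89.Missing
open Literature.MathematicalPhysics.QuantumFieldTheory.Balaban1983to89.T4Continuum
open scoped Literature.MathematicalPhysics.QuantumFieldTheory.Balaban1983to89.T3OrbitAverage
open Summit.QuantumFields.YangMills.Theorems.FluctuationComparisonRegPrIntLS2BetaCornerInTube
open Summit.QuantumFields.YangMills.Theorems.FluctuationComparisonRegPrIntLS2BetaTwoCornerEdge (sliceHessEntry_of_locallyConst)

namespace Summit.QuantumFields.YangMills.Theorems.FluctuationComparisonRegPrIntLS2BetaDetRepBOfCornerLetters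

/-! ## §1 The named slice-Hessian matrices of two-corner data, C²-free corner form -/

/-- ★ **THE NAMED MATRICES OF TWO-CORNER DATA, WITHOUT SMOOTHNESS**: for the locally constant edge `x := (A ∣ B)`, `y := (y_A ∣ y_B)` the slice-Hessian matrix (the body of
LINE g18-1's `hessStd`) of `q ↦ Act (Ψ (x q.1, σ q.2))` at `(0, y 0)` ∕ `(1, y 1)` is that of `q ↦ Act (Ψ (A, σ q.2))` at `((0 : ℝ), y_A)` ∕ of `q ↦ Act (Ψ (B, σ q.2))` at
`((1 : ℝ), y_B)` — entrywise ✓`sliceHessEntry_of_locallyConst` (the entry depends only on the germ); no `C²` row needed (contrast ✓`…CornerInTube.hessStd_text_twoCorner`).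
[cite: Dieudonne1960, Ch. X §2 (10.2.1) (bookkeeping); Balaban1985Variational, Thm 1 (10) p.279] -/
theorem sliceHessMatrix_twoCorner {D Zf : Type*} {n : ℕ} (Ψ : D × Zf → Zf) (Act : Zf → ℝ) (σ : EuclideanSpace ℝ (Fin n) → Zf)
    (A B : D) (yA yB : EuclideanSpace ℝ (Fin n)) :
    ((Matrix.of fun i j : Fin n => ((fderiv ℝ (fun q : ℝ × EuclideanSpace ℝ (Fin n) =>
        (fderiv ℝ (fun q : ℝ × EuclideanSpace ℝ (Fin n) =>
            Act (Ψ ((fun s : ℝ => if s < 2⁻¹ then A else B) q.1, σ q.2))) q).comp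
          (ContinuousLinearMap.inr ℝ ℝ (EuclideanSpace ℝ (Fin n))))
          (0, (fun s : ℝ => if s < 2⁻¹ then yA else yB) 0)).comp
        (ContinuousLinearMap.inr ℝ ℝ (EuclideanSpace ℝ (Fin n))))
        ((EuclideanSpace.basisFun (Fin n) ℝ) i) ((EuclideanSpace.basisFun (Fin n) ℝ) j)) =
      Matrix.of fun i j : Fin n => ((fderiv ℝ (fun q : ℝ × EuclideanSpace ℝ (Fin n) =>
        (fderiv ℝ (fun q : ℝ × EuclideanSpace ℝ (Fin n) => Act (Ψ (A, σ q.2))) q).comp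
          (ContinuousLinearMap.inr ℝ ℝ (EuclideanSpace ℝ (Fin n))))
          ((0 : ℝ), yA)).comp
        (ContinuousLinearMap.inr ℝ ℝ (EuclideanSpace ℝ (Fin n))))
        ((EuclideanSpace.basisFun (Fin n) ℝ) i) ((EuclideanSpace.basisFun (Fin n) ℝ) j)) ∧
    ((Matrix.of fun i j : Fin n => ((fderiv ℝ (fun q : ℝ × EuclideanSpace ℝ (Fin n) =>
        (fderiv ℝ (fun q : ℝ × EuclideanSpace ℝ (Fin n) =>
            Act (Ψ ((fun s : ℝ => if s < 2⁻¹ then A else B) q.1, σ q.2))) q).comp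
          (ContinuousLinearMap.inr ℝ ℝ (EuclideanSpace ℝ (Fin n))))
          (1, (fun s : ℝ => if s < 2⁻¹ then yA else yB) 1)).comp
        (ContinuousLinearMap.inr ℝ ℝ (EuclideanSpace ℝ (Fin n))))
        ((EuclideanSpace.basisFun (Fin n) ℝ) i) ((EuclideanSpace.basisFun (Fin n) ℝ) j)) =
      Matrix.of fun i j : Fin n => ((fderiv ℝ (fun q : ℝ × EuclideanSpace ℝ (Fin n) =>
        (fderiv ℝ (fun q : ℝ × EuclideanSpace ℝ (Fin n) => Act (Ψ (B, σ q.2))) q).comp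
          (ContinuousLinearMap.inr ℝ ℝ (EuclideanSpace ℝ (Fin n))))
          ((1 : ℝ), yB)).comp
        (ContinuousLinearMap.inr ℝ ℝ (EuclideanSpace ℝ (Fin n))))
        ((EuclideanSpace.basisFun (Fin n) ℝ) i) ((EuclideanSpace.basisFun (Fin n) ℝ) j)) := by
  obtain ⟨hx0, hy0, hx1, hy1⟩ := twoCorner_eventually A B yA yB
  constructor
  · ext i j
    rw [Matrix.of_apply, Matrix.of_apply, hy0]
    exact sliceHessEntry_of_locallyConst (fun (a : D) (v : EuclideanSpace ℝ (Fin n)) => Act (Ψ (a, σ v)))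
      (x := fun s : ℝ => if s < 2⁻¹ then A else B) (X := A) (s := (0 : ℝ)) hx0 yA
      ((EuclideanSpace.basisFun (Fin n) ℝ) i) ((EuclideanSpace.basisFun (Fin n) ℝ) j)
  · ext i j
    rw [Matrix.of_apply, Matrix.of_apply, hy1]
    exact sliceHessEntry_of_locallyConst (fun (a : D) (v : EuclideanSpace ℝ (Fin n)) => Act (Ψ (a, σ v)))
      (x := fun s : ℝ => if s < 2⁻¹ then A else B) (X := B) (s := (1 : ℝ)) hx1 yB
      ((EuclideanSpace.basisFun (Fin n) ℝ) i) ((EuclideanSpace.basisFun (Fin n) ℝ) j)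

/-! ## §2 The docking theorem -/

/-- ★★★ **DET-REP (B) FROM DET-REP (B)♭ — THE BODY OF `def DetRepB` TOKEN FOR TOKEN FROM THE CORNER-FORM ROW.**  See the module docstring for the shape of ♭ and the proof.
USE (Lines side, when ♭ has suppliers): `theorem stub_detRepB : DetRepB := detRepB_text_of_flat h♭` (δ-unfolding of `ChartRows`∕`ChartRowsJ`∕`TubeRows`∕`EdgeRows`∕`hessStd`).
[cite: Balaban1985Variational, Thm 1 (8)-(10) p.279 and (142) p.299; Balaban1984PropagatorsII, (1.33); Balaban1985UV3, (36)-(37) p.265] -/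
theorem detRepB_text_of_flat
    (hflat : ∀ (L : ℕ), ∃ c₀ : ℝ, 0 < c₀ ∧ c₀ ≤ 1 ∧ ∀ (cw : ℝ), 0 < cw → cw ≤ c₀ → ∃ pS : ℝ, ∀ (b₀ p₀ : ℝ), 0 < b₀ → pS ≤ p₀ → 0 < p₀ → ∃ ε₁ : ℝ, 0 < ε₁ ∧ ∀ (ε₀ : ℝ), 0 < ε₀ → ε₀ ≤ ε₁ →
        ∃ γ₁ : ℝ, 0 < γ₁ ∧ ∃ Cst θ θ₂ : ℝ, 0 ≤ Cst ∧ 0 ≤ θ₂ ∧ θ₂ < θ ∧ ∀ (F : T3Family) (γ : ℝ), F.L = L → 0 < γ → γ ≤ γ₁ →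
          ∀ (J K : ℕ) (hJK : J ≤ K)
            (c : Summit.QuantumFields.YangMills.Theorems.FluctuationComparisonRegPrIntLWregGlue.WindowChart F hJK (histGood F ℰp (θBal F.L γ b₀ p₀) K J) {V : GaugeField (F.P J) 0 (Matrix.specialUnitaryGroup (Fin 2) ℂ) | PlaqSmall (θBal F.L γ b₀ p₀ J) V}),
            (∀ V : GaugeField (F.P J) 0 (Matrix.specialUnitaryGroup (Fin 2) ℂ),
                IsCompact {z : GaugeField (F.P K) 0 (Matrix.specialUnitaryGroup (Fin 2) ℂ) | c.jac (V, z) ≠ 0} ∧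
                (∀ k z, z ∈ {z : GaugeField (F.P K) 0 (Matrix.specialUnitaryGroup (Fin 2) ℂ) | c.jac (V, z) ≠ 0} → Summit.QuantumFields.YangMills.Theorems.FluctuationComparisonRegPrIntLS2BetaResidualSubgroup.pivotAct F hJK (Summit.QuantumFields.YangMills.Theorems.FluctuationComparisonRegPrIntLWregChain.iterCentralBond (P := F.P K) (K - J)) k z ∈ {z : GaugeField (F.P K) 0 (Matrix.specialUnitaryGroup (Fin 2) ℂ) | c.jac (V, z) ≠ 0}) ∧
                (∀ z, z ∉ {z : GaugeField (F.P K) 0 (Matrix.specialUnitaryGroup (Fin 2) ℂ) | c.jac (V, z) ≠ 0} → (c.jac (V, z) : ℝ) = 0) ∧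
                ContinuousOn (fun z => wilsonAction4 (c.Φ (V, z))) {z : GaugeField (F.P K) 0 (Matrix.specialUnitaryGroup (Fin 2) ℂ) | c.jac (V, z) ≠ 0} ∧
                ContinuousOn (fun z => (c.jac (V, z) : ℝ)) {z : GaugeField (F.P K) 0 (Matrix.specialUnitaryGroup (Fin 2) ℂ) | c.jac (V, z) ≠ 0} ∧
                ContinuousOn (fun z => c.Φ (V, z)) {z : GaugeField (F.P K) 0 (Matrix.specialUnitaryGroup (Fin 2) ℂ) | c.jac (V, z) ≠ 0} ∧
                (∀ k, ∀ z ∈ {z : GaugeField (F.P K) 0 (Matrix.specialUnitaryGroup (Fin 2) ℂ) | c.jac (V, z) ≠ 0}, wilsonAction4 (c.Φ (V, Summit.QuantumFields.YangMills.Theorems.FluctuationComparisonRegPrIntLS2BetaResidualSubgroup.pivotAct F hJK (Summit.QuantumFields.YangMills.Theorems.FluctuationComparisonRegPrIntLWregChain.iterCentralBond (P := F.P K) (K - J)) k z)) = wilsonAction4 (c.Φ (V, z))) ∧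
                (∀ k, ∀ z ∈ {z : GaugeField (F.P K) 0 (Matrix.specialUnitaryGroup (Fin 2) ℂ) | c.jac (V, z) ≠ 0}, (c.jac (V, Summit.QuantumFields.YangMills.Theorems.FluctuationComparisonRegPrIntLS2BetaResidualSubgroup.pivotAct F hJK (Summit.QuantumFields.YangMills.Theorems.FluctuationComparisonRegPrIntLWregChain.iterCentralBond (P := F.P K) (K - J)) k z) : ℝ) = c.jac (V, z)) ∧
                IsOpen ((Subtype.val : {z : GaugeField (F.P K) 0 (Matrix.specialUnitaryGroup (Fin 2) ℂ) | c.jac (V, z) ≠ 0} → GaugeField (F.P K) 0 (Matrix.specialUnitaryGroup (Fin 2) ℂ)) ⁻¹' {z | c.Φ (V, z) ∈ (histGood F ℰp (θBal F.L γ b₀ p₀) K J)}) ∧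
                (∀ k, ∀ z ∈ {z : GaugeField (F.P K) 0 (Matrix.specialUnitaryGroup (Fin 2) ℂ) | c.jac (V, z) ≠ 0}, c.Φ (V, z) ∈ (histGood F ℰp (θBal F.L γ b₀ p₀) K J) → c.Φ (V, Summit.QuantumFields.YangMills.Theorems.FluctuationComparisonRegPrIntLS2BetaResidualSubgroup.pivotAct F hJK (Summit.QuantumFields.YangMills.Theorems.FluctuationComparisonRegPrIntLWregChain.iterCentralBond (P := F.P K) (K - J)) k z) ∈ (histGood F ℰp (θBal F.L γ b₀ p₀) K J)) ∧
                (∀ z ∈ {z : GaugeField (F.P K) 0 (Matrix.specialUnitaryGroup (Fin 2) ℂ) | c.jac (V, z) ≠ 0}, ∀ b, (∀ c', Summit.QuantumFields.YangMills.Theorems.FluctuationComparisonRegPrIntLWregChain.iterCentralBond (P := F.P K) (K - J) c' ≠ b) → c.Φ (V, z) b = z b) ∧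
                (∀ z ∈ {z : GaugeField (F.P K) 0 (Matrix.specialUnitaryGroup (Fin 2) ℂ) | c.jac (V, z) ≠ 0}, descendTo F ℰp J K hJK (c.Φ (V, z)) = V) ∧
                (∀ U, descendTo F ℰp J K hJK U = V → U ∈ (histGood F ℰp (θBal F.L γ b₀ p₀) K J) → (c.jac (V, U) ≠ 0 ∧ c.Φ (V, U) = U) ∧ {z : GaugeField (F.P K) 0 (Matrix.specialUnitaryGroup (Fin 2) ℂ) | c.jac (V, z) ≠ 0} ∈ 𝓝 U)) →
            ((∀ V z (g : PBond (F.P K) (K - J) → Matrix.specialUnitaryGroup (Fin 2) ℂ), c.jac (V, z) ≠ 0 →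
                c.Φ (V, Function.extend (Summit.QuantumFields.YangMills.Theorems.FluctuationComparisonRegPrIntLWregChain.iterCentralBond (P := F.P K) (K - J)) g z) = c.Φ (V, z)) ∧
              (∀ V z (g : PBond (F.P K) (K - J) → Matrix.specialUnitaryGroup (Fin 2) ℂ),
                c.jac (V, Function.extend (Summit.QuantumFields.YangMills.Theorems.FluctuationComparisonRegPrIntLWregChain.iterCentralBond (P := F.P K) (K - J)) g z) = c.jac (V, z)) ∧
              ContinuousOn (fun q => c.Φ q) {q : GaugeField (F.P J) 0 (Matrix.specialUnitaryGroup (Fin 2) ℂ) × GaugeField (F.P K) 0 (Matrix.specialUnitaryGroup (Fin 2) ℂ) | c.jac q ≠ 0}) →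
            ∀ (b b' : PBond (F.P J) 0) (U V W Z : GaugeField (F.P J) 0 (Matrix.specialUnitaryGroup (Fin 2) ℂ)),
              PlaqSmall (θBal F.L γ (cw * b₀) p₀ J) U → PlaqSmall (θBal F.L γ (cw * b₀) p₀ J) V →
              PlaqSmall (θBal F.L γ (cw * b₀) p₀ J) W → PlaqSmall (θBal F.L γ (cw * b₀) p₀ J) Z →
              (∀ e, e ≠ b → U e = V e) → (∀ e, e ≠ b' → U e = W e) → (∀ e, e ≠ b' → V e = Z e) → (∀ e, e ≠ b → W e = Z e) →
            ∃ (dZ dV : ℕ)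
              (e : EuclideanSpace ℝ (Fin dZ) → ↥(Summit.QuantumFields.YangMills.Theorems.FluctuationComparisonRegPrIntLS2BetaResidualSubgroup.residualSubgroup F hJK) × (PBond (F.P K) (K - J) → Matrix.specialUnitaryGroup (Fin 2) ℂ))
              (σ : EuclideanSpace ℝ (Fin dV) → GaugeField (F.P K) 0 (Matrix.specialUnitaryGroup (Fin 2) ℂ))
              (UZ : Set (EuclideanSpace ℝ (Fin dZ))) (UV : Set (EuclideanSpace ℝ (Fin dV)))
              (jZ : EuclideanSpace ℝ (Fin dZ) → ℝ) (jV : EuclideanSpace ℝ (Fin dV) → ℝ) (ρ : ℝ)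
              (uU uV uW uZ : GaugeField (F.P K) 0 (Matrix.specialUnitaryGroup (Fin 2) ℂ))
              (kU kV kW kZ : ↥(Summit.QuantumFields.YangMills.Theorems.FluctuationComparisonRegPrIntLS2BetaResidualSubgroup.residualSubgroup F hJK) × (PBond (F.P K) (K - J) → Matrix.specialUnitaryGroup (Fin 2) ℂ))
              (yU yV yW yZ : EuclideanSpace ℝ (Fin dV)),
              (Continuous e ∧ e 0 = 1 ∧
                𝓝 (1 : ↥(Summit.QuantumFields.YangMills.Theorems.FluctuationComparisonRegPrIntLS2BetaResidualSubgroup.residualSubgroup F hJK) × (PBond (F.P K) (K - J) → Matrix.specialUnitaryGroup (Fin 2) ℂ)) ≤ map e (𝓝 0) ∧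
                Continuous σ ∧
                ContDiff ℝ ⊤ (fun y : EuclideanSpace ℝ (Fin dV) => fun b : PBond (F.P K) 0 => ((σ y b : Matrix.specialUnitaryGroup (Fin 2) ℂ) : Matrix (Fin 2) (Fin 2) ℂ)) ∧
                IsOpen UZ ∧ IsOpen UV ∧ (0 : EuclideanSpace ℝ (Fin dZ)) ∈ UZ ∧
                (∀ y₁ ∈ UV, ∃ c : ℝ, 0 < c ∧ ∀ᶠ v in 𝓝 (0 : EuclideanSpace ℝ (Fin dV)),
                  c * ‖v‖ ^ 2 ≤ ⨅ w : {w : Site (F.P K) 0 → Matrix.specialUnitaryGroup (Fin 2) ℂ |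
                        ∀ U : GaugeField (F.P K) 0 (Matrix.specialUnitaryGroup (Fin 2) ℂ),
                          descendTo F ℰp J K hJK (GaugeField.gaugeAct w U) = descendTo F ℰp J K hJK U},
                      ∑ ℓ ∈ Finset.univ.filter (fun ℓ : PBond (F.P K) 0 =>
                          ∀ c', Summit.QuantumFields.YangMills.Theorems.FluctuationComparisonRegPrIntLWregChain.iterCentralBond (P := F.P K) (K - J) c' ≠ ℓ),
                        dist1 (σ (y₁ + v) ℓ * ((GaugeField.gaugeAct (w : Site (F.P K) 0 → Matrix.specialUnitaryGroup (Fin 2) ℂ) (σ y₁)) ℓ)⁻¹) ^ 2) ∧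
                InjOn (fun p : EuclideanSpace ℝ (Fin dZ) × EuclideanSpace ℝ (Fin dV) =>
                  Summit.QuantumFields.YangMills.Theorems.FluctuationComparisonRegPrIntLS2BetaResidualSubgroup.pivotAct F hJK (Summit.QuantumFields.YangMills.Theorems.FluctuationComparisonRegPrIntLWregChain.iterCentralBond (P := F.P K) (K - J)) (e p.1) (σ p.2)) (UZ ×ˢ UV) ∧
                (∀ p ∈ UZ ×ˢ UV, ∀ s ∈ 𝓝 p, (fun p : EuclideanSpace ℝ (Fin dZ) × EuclideanSpace ℝ (Fin dV) =>
                  Summit.QuantumFields.YangMills.Theorems.FluctuationComparisonRegPrIntLS2BetaResidualSubgroup.pivotAct F hJK (Summit.QuantumFields.YangMills.Theorems.FluctuationComparisonRegPrIntLWregChain.iterCentralBond (P := F.P K) (K - J)) (e p.1) (σ p.2)) '' s ∈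
                  𝓝 ((fun p : EuclideanSpace ℝ (Fin dZ) × EuclideanSpace ℝ (Fin dV) =>
                  Summit.QuantumFields.YangMills.Theorems.FluctuationComparisonRegPrIntLS2BetaResidualSubgroup.pivotAct F hJK (Summit.QuantumFields.YangMills.Theorems.FluctuationComparisonRegPrIntLWregChain.iterCentralBond (P := F.P K) (K - J)) (e p.1) (σ p.2)) p)) ∧
                ContinuousOn jZ UZ ∧ ContinuousOn jV UV ∧ (∀ z ∈ UZ, 0 ≤ jZ z) ∧ (∀ y ∈ UV, 0 ≤ jV y) ∧
                (fieldMeasure (F.P K) 0 (Matrix.specialUnitaryGroup (Fin 2) ℂ)).restrict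
                    ((fun p : EuclideanSpace ℝ (Fin dZ) × EuclideanSpace ℝ (Fin dV) =>
                      Summit.QuantumFields.YangMills.Theorems.FluctuationComparisonRegPrIntLS2BetaResidualSubgroup.pivotAct F hJK (Summit.QuantumFields.YangMills.Theorems.FluctuationComparisonRegPrIntLWregChain.iterCentralBond (P := F.P K) (K - J)) (e p.1) (σ p.2)) '' (UZ ×ˢ UV)) =
                  ((((volume : Measure (EuclideanSpace ℝ (Fin dZ))).prod (volume : Measure (EuclideanSpace ℝ (Fin dV)))).restrict (UZ ×ˢ UV)).withDensity
                      fun w => ENNReal.ofReal (jZ w.1 * jV w.2)).map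
                    (fun p : EuclideanSpace ℝ (Fin dZ) × EuclideanSpace ℝ (Fin dV) =>
                      Summit.QuantumFields.YangMills.Theorems.FluctuationComparisonRegPrIntLS2BetaResidualSubgroup.pivotAct F hJK (Summit.QuantumFields.YangMills.Theorems.FluctuationComparisonRegPrIntLWregChain.iterCentralBond (P := F.P K) (K - J)) (e p.1) (σ p.2)) ∧
                0 < ρ ∧ Metric.closedBall (0 : EuclideanSpace ℝ (Fin dZ)) ρ ⊆ UZ ∧ 0 < ∫ z in Metric.ball (0 : EuclideanSpace ℝ (Fin dZ)) ρ, jZ z) ∧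
              (uU ∈ fibre F ℰp J K hJK U ∧ uU ∈ histGood F ℰp (θBal F.L γ b₀ p₀) K J ∧ wilsonAction4 uU = minActionRegPr F J K hJK ε₀ U) ∧ (uV ∈ fibre F ℰp J K hJK V ∧ uV ∈ histGood F ℰp (θBal F.L γ b₀ p₀) K J ∧ wilsonAction4 uV = minActionRegPr F J K hJK ε₀ V) ∧
              (uW ∈ fibre F ℰp J K hJK W ∧ uW ∈ histGood F ℰp (θBal F.L γ b₀ p₀) K J ∧ wilsonAction4 uW = minActionRegPr F J K hJK ε₀ W) ∧ (uZ ∈ fibre F ℰp J K hJK Z ∧ uZ ∈ histGood F ℰp (θBal F.L γ b₀ p₀) K J ∧ wilsonAction4 uZ = minActionRegPr F J K hJK ε₀ Z) ∧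
              (Summit.QuantumFields.YangMills.Theorems.FluctuationComparisonRegPrIntLS2BetaResidualSubgroup.pivotAct F hJK (Summit.QuantumFields.YangMills.Theorems.FluctuationComparisonRegPrIntLWregChain.iterCentralBond (P := F.P K) (K - J)) kU (σ yU) = uU ∧ yU ∈ UV ∧ 0 < jV yU) ∧
              (Summit.QuantumFields.YangMills.Theorems.FluctuationComparisonRegPrIntLS2BetaResidualSubgroup.pivotAct F hJK (Summit.QuantumFields.YangMills.Theorems.FluctuationComparisonRegPrIntLWregChain.iterCentralBond (P := F.P K) (K - J)) kV (σ yV) = uV ∧ yV ∈ UV ∧ 0 < jV yV) ∧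
              (Summit.QuantumFields.YangMills.Theorems.FluctuationComparisonRegPrIntLS2BetaResidualSubgroup.pivotAct F hJK (Summit.QuantumFields.YangMills.Theorems.FluctuationComparisonRegPrIntLWregChain.iterCentralBond (P := F.P K) (K - J)) kW (σ yW) = uW ∧ yW ∈ UV ∧ 0 < jV yW) ∧
              (Summit.QuantumFields.YangMills.Theorems.FluctuationComparisonRegPrIntLS2BetaResidualSubgroup.pivotAct F hJK (Summit.QuantumFields.YangMills.Theorems.FluctuationComparisonRegPrIntLWregChain.iterCentralBond (P := F.P K) (K - J)) kZ (σ yZ) = uZ ∧ yZ ∈ UV ∧ 0 < jV yZ) ∧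
              |(Real.log (Matrix.of fun i j => ((fderiv ℝ (fun q : ℝ × EuclideanSpace ℝ (Fin dV) =>     (fderiv ℝ (fun q : ℝ × EuclideanSpace ℝ (Fin dV) => wilsonAction4 (c.Φ (U, σ q.2))) q).comp (ContinuousLinearMap.inr ℝ ℝ (EuclideanSpace ℝ (Fin dV)))) ((0 : ℝ), yU)).comp   (ContinuousLinearMap.inr ℝ ℝ (EuclideanSpace ℝ (Fin dV))))   ((EuclideanSpace.basisFun (Fin dV) ℝ) i) ((EuclideanSpace.basisFun (Fin dV) ℝ) j)).det - 2 * Real.log (jV yU))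
                  - (Real.log (Matrix.of fun i j => ((fderiv ℝ (fun q : ℝ × EuclideanSpace ℝ (Fin dV) =>     (fderiv ℝ (fun q : ℝ × EuclideanSpace ℝ (Fin dV) => wilsonAction4 (c.Φ (V, σ q.2))) q).comp (ContinuousLinearMap.inr ℝ ℝ (EuclideanSpace ℝ (Fin dV)))) ((1 : ℝ), yV)).comp   (ContinuousLinearMap.inr ℝ ℝ (EuclideanSpace ℝ (Fin dV))))   ((EuclideanSpace.basisFun (Fin dV) ℝ) i) ((EuclideanSpace.basisFun (Fin dV) ℝ) j)).det - 2 * Real.log (jV yV))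
                  - ((Real.log (Matrix.of fun i j => ((fderiv ℝ (fun q : ℝ × EuclideanSpace ℝ (Fin dV) =>     (fderiv ℝ (fun q : ℝ × EuclideanSpace ℝ (Fin dV) => wilsonAction4 (c.Φ (W, σ q.2))) q).comp (ContinuousLinearMap.inr ℝ ℝ (EuclideanSpace ℝ (Fin dV)))) ((0 : ℝ), yW)).comp   (ContinuousLinearMap.inr ℝ ℝ (EuclideanSpace ℝ (Fin dV))))   ((EuclideanSpace.basisFun (Fin dV) ℝ) i) ((EuclideanSpace.basisFun (Fin dV) ℝ) j)).det - 2 * Real.log (jV yW))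
                    - (Real.log (Matrix.of fun i j => ((fderiv ℝ (fun q : ℝ × EuclideanSpace ℝ (Fin dV) =>     (fderiv ℝ (fun q : ℝ × EuclideanSpace ℝ (Fin dV) => wilsonAction4 (c.Φ (Z, σ q.2))) q).comp (ContinuousLinearMap.inr ℝ ℝ (EuclideanSpace ℝ (Fin dV)))) ((1 : ℝ), yZ)).comp   (ContinuousLinearMap.inr ℝ ℝ (EuclideanSpace ℝ (Fin dV))))   ((EuclideanSpace.basisFun (Fin dV) ℝ) i) ((EuclideanSpace.basisFun (Fin dV) ℝ) j)).det - 2 * Real.log (jV yZ)))|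
                ≤ 2 * Cst * θBal F.L γ b₀ p₀ J ^ 2 * Real.exp (-((θ - θ₂) * (b.src.tdist b'.src : ℝ))) ∧
              |Real.log (c.jac (U, σ yU)) - Real.log (c.jac (V, σ yV))
                  - (Real.log (c.jac (W, σ yW)) - Real.log (c.jac (Z, σ yZ)))|
                ≤ Cst * θBal F.L γ b₀ p₀ J ^ 2 * Real.exp (-((θ - θ₂) * (b.src.tdist b'.src : ℝ)))) :
    ∀ (L : ℕ), ∃ c₀ : ℝ, 0 < c₀ ∧ c₀ ≤ 1 ∧ ∀ (cw : ℝ), 0 < cw → cw ≤ c₀ → ∃ pS : ℝ, ∀ (b₀ p₀ : ℝ), 0 < b₀ → pS ≤ p₀ → 0 < p₀ → ∃ ε₁ : ℝ, 0 < ε₁ ∧ ∀ (ε₀ : ℝ), 0 < ε₀ → ε₀ ≤ ε₁ →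
      ∃ γ₁ : ℝ, 0 < γ₁ ∧ ∃ Cst θ θ₂ : ℝ, 0 ≤ Cst ∧ 0 ≤ θ₂ ∧ θ₂ < θ ∧ ∀ (F : T3Family) (γ : ℝ), F.L = L → 0 < γ → γ ≤ γ₁ →
        ∀ (J K : ℕ) (hJK : J ≤ K)
          (c : Summit.QuantumFields.YangMills.Theorems.FluctuationComparisonRegPrIntLWregGlue.WindowChart F hJK (histGood F ℰp (θBal F.L γ b₀ p₀) K J) {V : GaugeField (F.P J) 0 (Matrix.specialUnitaryGroup (Fin 2) ℂ) | PlaqSmall (θBal F.L γ b₀ p₀ J) V}),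
          (∀ V : GaugeField (F.P J) 0 (Matrix.specialUnitaryGroup (Fin 2) ℂ),
              IsCompact {z : GaugeField (F.P K) 0 (Matrix.specialUnitaryGroup (Fin 2) ℂ) | c.jac (V, z) ≠ 0} ∧
              (∀ k z, z ∈ {z : GaugeField (F.P K) 0 (Matrix.specialUnitaryGroup (Fin 2) ℂ) | c.jac (V, z) ≠ 0} → Summit.QuantumFields.YangMills.Theorems.FluctuationComparisonRegPrIntLS2BetaResidualSubgroup.pivotAct F hJK (Summit.QuantumFields.YangMills.Theorems.FluctuationComparisonRegPrIntLWregChain.iterCentralBond (P := F.P K) (K - J)) k z ∈ {z : GaugeField (F.P K) 0 (Matrix.specialUnitaryGroup (Fin 2) ℂ) | c.jac (V, z) ≠ 0}) ∧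
              (∀ z, z ∉ {z : GaugeField (F.P K) 0 (Matrix.specialUnitaryGroup (Fin 2) ℂ) | c.jac (V, z) ≠ 0} → (c.jac (V, z) : ℝ) = 0) ∧
              ContinuousOn (fun z => wilsonAction4 (c.Φ (V, z))) {z : GaugeField (F.P K) 0 (Matrix.specialUnitaryGroup (Fin 2) ℂ) | c.jac (V, z) ≠ 0} ∧
              ContinuousOn (fun z => (c.jac (V, z) : ℝ)) {z : GaugeField (F.P K) 0 (Matrix.specialUnitaryGroup (Fin 2) ℂ) | c.jac (V, z) ≠ 0} ∧
              ContinuousOn (fun z => c.Φ (V, z)) {z : GaugeField (F.P K) 0 (Matrix.specialUnitaryGroup (Fin 2) ℂ) | c.jac (V, z) ≠ 0} ∧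
              (∀ k, ∀ z ∈ {z : GaugeField (F.P K) 0 (Matrix.specialUnitaryGroup (Fin 2) ℂ) | c.jac (V, z) ≠ 0}, wilsonAction4 (c.Φ (V, Summit.QuantumFields.YangMills.Theorems.FluctuationComparisonRegPrIntLS2BetaResidualSubgroup.pivotAct F hJK (Summit.QuantumFields.YangMills.Theorems.FluctuationComparisonRegPrIntLWregChain.iterCentralBond (P := F.P K) (K - J)) k z)) = wilsonAction4 (c.Φ (V, z))) ∧
              (∀ k, ∀ z ∈ {z : GaugeField (F.P K) 0 (Matrix.specialUnitaryGroup (Fin 2) ℂ) | c.jac (V, z) ≠ 0}, (c.jac (V, Summit.QuantumFields.YangMills.Theorems.FluctuationComparisonRegPrIntLS2BetaResidualSubgroup.pivotAct F hJK (Summit.QuantumFields.YangMills.Theorems.FluctuationComparisonRegPrIntLWregChain.iterCentralBond (P := F.P K) (K - J)) k z) : ℝ) = c.jac (V, z)) ∧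
              IsOpen ((Subtype.val : {z : GaugeField (F.P K) 0 (Matrix.specialUnitaryGroup (Fin 2) ℂ) | c.jac (V, z) ≠ 0} → GaugeField (F.P K) 0 (Matrix.specialUnitaryGroup (Fin 2) ℂ)) ⁻¹' {z | c.Φ (V, z) ∈ (histGood F ℰp (θBal F.L γ b₀ p₀) K J)}) ∧
              (∀ k, ∀ z ∈ {z : GaugeField (F.P K) 0 (Matrix.specialUnitaryGroup (Fin 2) ℂ) | c.jac (V, z) ≠ 0}, c.Φ (V, z) ∈ (histGood F ℰp (θBal F.L γ b₀ p₀) K J) → c.Φ (V, Summit.QuantumFields.YangMills.Theorems.FluctuationComparisonRegPrIntLS2BetaResidualSubgroup.pivotAct F hJK (Summit.QuantumFields.YangMills.Theorems.FluctuationComparisonRegPrIntLWregChain.iterCentralBond (P := F.P K) (K - J)) k z) ∈ (histGood F ℰp (θBal F.L γ b₀ p₀) K J)) ∧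
              (∀ z ∈ {z : GaugeField (F.P K) 0 (Matrix.specialUnitaryGroup (Fin 2) ℂ) | c.jac (V, z) ≠ 0}, ∀ b, (∀ c', Summit.QuantumFields.YangMills.Theorems.FluctuationComparisonRegPrIntLWregChain.iterCentralBond (P := F.P K) (K - J) c' ≠ b) → c.Φ (V, z) b = z b) ∧
              (∀ z ∈ {z : GaugeField (F.P K) 0 (Matrix.specialUnitaryGroup (Fin 2) ℂ) | c.jac (V, z) ≠ 0}, descendTo F ℰp J K hJK (c.Φ (V, z)) = V) ∧
              (∀ U, descendTo F ℰp J K hJK U = V → U ∈ (histGood F ℰp (θBal F.L γ b₀ p₀) K J) → (c.jac (V, U) ≠ 0 ∧ c.Φ (V, U) = U) ∧ {z : GaugeField (F.P K) 0 (Matrix.specialUnitaryGroup (Fin 2) ℂ) | c.jac (V, z) ≠ 0} ∈ 𝓝 U)) →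
          ((∀ V z (g : PBond (F.P K) (K - J) → Matrix.specialUnitaryGroup (Fin 2) ℂ), c.jac (V, z) ≠ 0 →
              c.Φ (V, Function.extend (Summit.QuantumFields.YangMills.Theorems.FluctuationComparisonRegPrIntLWregChain.iterCentralBond (P := F.P K) (K - J)) g z) = c.Φ (V, z)) ∧
            (∀ V z (g : PBond (F.P K) (K - J) → Matrix.specialUnitaryGroup (Fin 2) ℂ),
              c.jac (V, Function.extend (Summit.QuantumFields.YangMills.Theorems.FluctuationComparisonRegPrIntLWregChain.iterCentralBond (P := F.P K) (K - J)) g z) = c.jac (V, z)) ∧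
            ContinuousOn (fun q => c.Φ q) {q : GaugeField (F.P J) 0 (Matrix.specialUnitaryGroup (Fin 2) ℂ) × GaugeField (F.P K) 0 (Matrix.specialUnitaryGroup (Fin 2) ℂ) | c.jac q ≠ 0}) →
          ∀ (b b' : PBond (F.P J) 0) (U V W Z : GaugeField (F.P J) 0 (Matrix.specialUnitaryGroup (Fin 2) ℂ)),
            PlaqSmall (θBal F.L γ (cw * b₀) p₀ J) U → PlaqSmall (θBal F.L γ (cw * b₀) p₀ J) V →
            PlaqSmall (θBal F.L γ (cw * b₀) p₀ J) W → PlaqSmall (θBal F.L γ (cw * b₀) p₀ J) Z →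
            (∀ e, e ≠ b → U e = V e) → (∀ e, e ≠ b' → U e = W e) → (∀ e, e ≠ b' → V e = Z e) → (∀ e, e ≠ b → W e = Z e) →
            ∃ (dZ dV : ℕ)
              (e : EuclideanSpace ℝ (Fin dZ) → ↥(Summit.QuantumFields.YangMills.Theorems.FluctuationComparisonRegPrIntLS2BetaResidualSubgroup.residualSubgroup F hJK) × (PBond (F.P K) (K - J) → Matrix.specialUnitaryGroup (Fin 2) ℂ))
              (σ : EuclideanSpace ℝ (Fin dV) → GaugeField (F.P K) 0 (Matrix.specialUnitaryGroup (Fin 2) ℂ))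
              (UZ : Set (EuclideanSpace ℝ (Fin dZ))) (UV : Set (EuclideanSpace ℝ (Fin dV)))
              (jZ : EuclideanSpace ℝ (Fin dZ) → ℝ) (jV : EuclideanSpace ℝ (Fin dV) → ℝ) (ρ : ℝ)
              (I : Set ℝ) (x₀ x₁ : ℝ → GaugeField (F.P J) 0 (Matrix.specialUnitaryGroup (Fin 2) ℂ)) (y₀ y₁ : ℝ → EuclideanSpace ℝ (Fin dV)),
              (Continuous e ∧ e 0 = 1 ∧
              𝓝 (1 : ↥(Summit.QuantumFields.YangMills.Theorems.FluctuationComparisonRegPrIntLS2BetaResidualSubgroup.residualSubgroup F hJK) × (PBond (F.P K) (K - J) → Matrix.specialUnitaryGroup (Fin 2) ℂ)) ≤ map e (𝓝 0) ∧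
              Continuous σ ∧
              ContDiff ℝ ⊤ (fun y : EuclideanSpace ℝ (Fin dV) => fun b : PBond (F.P K) 0 => ((σ y b : Matrix.specialUnitaryGroup (Fin 2) ℂ) : Matrix (Fin 2) (Fin 2) ℂ)) ∧
              IsOpen UZ ∧ IsOpen UV ∧ (0 : EuclideanSpace ℝ (Fin dZ)) ∈ UZ ∧
              (∀ y₁ ∈ UV, ∃ c : ℝ, 0 < c ∧ ∀ᶠ v in 𝓝 (0 : EuclideanSpace ℝ (Fin dV)),
                c * ‖v‖ ^ 2 ≤ ⨅ w : {w : Site (F.P K) 0 → Matrix.specialUnitaryGroup (Fin 2) ℂ |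
                      ∀ U : GaugeField (F.P K) 0 (Matrix.specialUnitaryGroup (Fin 2) ℂ),
                        descendTo F ℰp J K hJK (GaugeField.gaugeAct w U) = descendTo F ℰp J K hJK U},
                    ∑ ℓ ∈ Finset.univ.filter (fun ℓ : PBond (F.P K) 0 =>
                        ∀ c', Summit.QuantumFields.YangMills.Theorems.FluctuationComparisonRegPrIntLWregChain.iterCentralBond (P := F.P K) (K - J) c' ≠ ℓ),
                      dist1 (σ (y₁ + v) ℓ * ((GaugeField.gaugeAct (w : Site (F.P K) 0 → Matrix.specialUnitaryGroup (Fin 2) ℂ) (σ y₁)) ℓ)⁻¹) ^ 2) ∧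
              InjOn (fun p : EuclideanSpace ℝ (Fin dZ) × EuclideanSpace ℝ (Fin dV) =>
                Summit.QuantumFields.YangMills.Theorems.FluctuationComparisonRegPrIntLS2BetaResidualSubgroup.pivotAct F hJK (Summit.QuantumFields.YangMills.Theorems.FluctuationComparisonRegPrIntLWregChain.iterCentralBond (P := F.P K) (K - J)) (e p.1) (σ p.2)) (UZ ×ˢ UV) ∧
              (∀ p ∈ UZ ×ˢ UV, ∀ s ∈ 𝓝 p, (fun p : EuclideanSpace ℝ (Fin dZ) × EuclideanSpace ℝ (Fin dV) =>
                Summit.QuantumFields.YangMills.Theorems.FluctuationComparisonRegPrIntLS2BetaResidualSubgroup.pivotAct F hJK (Summit.QuantumFields.YangMills.Theorems.FluctuationComparisonRegPrIntLWregChain.iterCentralBond (P := F.P K) (K - J)) (e p.1) (σ p.2)) '' s ∈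
                𝓝 ((fun p : EuclideanSpace ℝ (Fin dZ) × EuclideanSpace ℝ (Fin dV) =>
                Summit.QuantumFields.YangMills.Theorems.FluctuationComparisonRegPrIntLS2BetaResidualSubgroup.pivotAct F hJK (Summit.QuantumFields.YangMills.Theorems.FluctuationComparisonRegPrIntLWregChain.iterCentralBond (P := F.P K) (K - J)) (e p.1) (σ p.2)) p)) ∧
              ContinuousOn jZ UZ ∧ ContinuousOn jV UV ∧ (∀ z ∈ UZ, 0 ≤ jZ z) ∧ (∀ y ∈ UV, 0 ≤ jV y) ∧
              (fieldMeasure (F.P K) 0 (Matrix.specialUnitaryGroup (Fin 2) ℂ)).restrict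
                  ((fun p : EuclideanSpace ℝ (Fin dZ) × EuclideanSpace ℝ (Fin dV) =>
                    Summit.QuantumFields.YangMills.Theorems.FluctuationComparisonRegPrIntLS2BetaResidualSubgroup.pivotAct F hJK (Summit.QuantumFields.YangMills.Theorems.FluctuationComparisonRegPrIntLWregChain.iterCentralBond (P := F.P K) (K - J)) (e p.1) (σ p.2)) '' (UZ ×ˢ UV)) =
                ((((volume : Measure (EuclideanSpace ℝ (Fin dZ))).prod (volume : Measure (EuclideanSpace ℝ (Fin dV)))).restrict (UZ ×ˢ UV)).withDensity
                    fun w => ENNReal.ofReal (jZ w.1 * jV w.2)).map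
                  (fun p : EuclideanSpace ℝ (Fin dZ) × EuclideanSpace ℝ (Fin dV) =>
                    Summit.QuantumFields.YangMills.Theorems.FluctuationComparisonRegPrIntLS2BetaResidualSubgroup.pivotAct F hJK (Summit.QuantumFields.YangMills.Theorems.FluctuationComparisonRegPrIntLWregChain.iterCentralBond (P := F.P K) (K - J)) (e p.1) (σ p.2)) ∧
              0 < ρ ∧ Metric.closedBall (0 : EuclideanSpace ℝ (Fin dZ)) ρ ⊆ UZ ∧ 0 < ∫ z in Metric.ball (0 : EuclideanSpace ℝ (Fin dZ)) ρ, jZ z) ∧ IsOpen I ∧ ((0 : ℝ) ∈ I ∧ (1 : ℝ) ∈ I) ∧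
              (x₀ 0 = U ∧ x₀ 1 = V ∧
              ∀ s ∈ I,
                PlaqSmall (θBal F.L γ (cw * b₀) p₀ J) (x₀ s) ∧ (∀ e', e' ≠ b → x₀ s e' = U e') ∧
                ContinuousAt x₀ s ∧
                ContDiffAt ℝ ⊤ (fun s' : ℝ => fun b : PBond (F.P J) 0 => ((x₀ s' b : Matrix.specialUnitaryGroup (Fin 2) ℂ) : Matrix (Fin 2) (Fin 2) ℂ)) s ∧
                y₀ s ∈ UV ∧ 0 < jV (y₀ s) ∧
                (∀ᶠ q in 𝓝 ((s : ℝ), y₀ s), c.jac (x₀ q.1, σ q.2) ≠ 0) ∧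
                c.Φ (x₀ s, σ (y₀ s)) ∈ histGood F ℰp (θBal F.L γ b₀ p₀) K J ∧
                wilsonAction4 (c.Φ (x₀ s, σ (y₀ s))) = minActionRegPr F J K hJK ε₀ (x₀ s) ∧
                ContinuousAt y₀ s) ∧
              (x₁ 0 = W ∧ x₁ 1 = Z ∧
              ∀ s ∈ I,
                PlaqSmall (θBal F.L γ (cw * b₀) p₀ J) (x₁ s) ∧ (∀ e', e' ≠ b → x₁ s e' = W e') ∧
                ContinuousAt x₁ s ∧
                ContDiffAt ℝ ⊤ (fun s' : ℝ => fun b : PBond (F.P J) 0 => ((x₁ s' b : Matrix.specialUnitaryGroup (Fin 2) ℂ) : Matrix (Fin 2) (Fin 2) ℂ)) s ∧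
                y₁ s ∈ UV ∧ 0 < jV (y₁ s) ∧
                (∀ᶠ q in 𝓝 ((s : ℝ), y₁ s), c.jac (x₁ q.1, σ q.2) ≠ 0) ∧
                c.Φ (x₁ s, σ (y₁ s)) ∈ histGood F ℰp (θBal F.L γ b₀ p₀) K J ∧
                wilsonAction4 (c.Φ (x₁ s, σ (y₁ s))) = minActionRegPr F J K hJK ε₀ (x₁ s) ∧
                ContinuousAt y₁ s) ∧
              |(Real.log ((Matrix.of fun i j => ((fderiv ℝ (fun q : ℝ × EuclideanSpace ℝ (Fin dV) =>     (fderiv ℝ (fun q : ℝ × EuclideanSpace ℝ (Fin dV) => wilsonAction4 (c.Φ (x₀ q.1, σ q.2))) q).comp (ContinuousLinearMap.inr ℝ ℝ (EuclideanSpace ℝ (Fin dV)))) (0, y₀ 0)).comp   (ContinuousLinearMap.inr ℝ ℝ (EuclideanSpace ℝ (Fin dV))))   ((EuclideanSpace.basisFun (Fin dV) ℝ) i) ((EuclideanSpace.basisFun (Fin dV) ℝ) j))).det - 2 * Real.log (jV (y₀ 0)))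
                  - (Real.log ((Matrix.of fun i j => ((fderiv ℝ (fun q : ℝ × EuclideanSpace ℝ (Fin dV) =>     (fderiv ℝ (fun q : ℝ × EuclideanSpace ℝ (Fin dV) => wilsonAction4 (c.Φ (x₀ q.1, σ q.2))) q).comp (ContinuousLinearMap.inr ℝ ℝ (EuclideanSpace ℝ (Fin dV)))) (1, y₀ 1)).comp   (ContinuousLinearMap.inr ℝ ℝ (EuclideanSpace ℝ (Fin dV))))   ((EuclideanSpace.basisFun (Fin dV) ℝ) i) ((EuclideanSpace.basisFun (Fin dV) ℝ) j))).det - 2 * Real.log (jV (y₀ 1)))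
                  - ((Real.log ((Matrix.of fun i j => ((fderiv ℝ (fun q : ℝ × EuclideanSpace ℝ (Fin dV) =>     (fderiv ℝ (fun q : ℝ × EuclideanSpace ℝ (Fin dV) => wilsonAction4 (c.Φ (x₁ q.1, σ q.2))) q).comp (ContinuousLinearMap.inr ℝ ℝ (EuclideanSpace ℝ (Fin dV)))) (0, y₁ 0)).comp   (ContinuousLinearMap.inr ℝ ℝ (EuclideanSpace ℝ (Fin dV))))   ((EuclideanSpace.basisFun (Fin dV) ℝ) i) ((EuclideanSpace.basisFun (Fin dV) ℝ) j))).det - 2 * Real.log (jV (y₁ 0)))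
                    - (Real.log ((Matrix.of fun i j => ((fderiv ℝ (fun q : ℝ × EuclideanSpace ℝ (Fin dV) =>     (fderiv ℝ (fun q : ℝ × EuclideanSpace ℝ (Fin dV) => wilsonAction4 (c.Φ (x₁ q.1, σ q.2))) q).comp (ContinuousLinearMap.inr ℝ ℝ (EuclideanSpace ℝ (Fin dV)))) (1, y₁ 1)).comp   (ContinuousLinearMap.inr ℝ ℝ (EuclideanSpace ℝ (Fin dV))))   ((EuclideanSpace.basisFun (Fin dV) ℝ) i) ((EuclideanSpace.basisFun (Fin dV) ℝ) j))).det - 2 * Real.log (jV (y₁ 1))))|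
                ≤ 2 * Cst * θBal F.L γ b₀ p₀ J ^ 2 * Real.exp (-((θ - θ₂) * (b.src.tdist b'.src : ℝ))) ∧
              |Real.log (c.jac (x₀ 0, σ (y₀ 0))) - Real.log (c.jac (x₀ 1, σ (y₀ 1)))
                  - (Real.log (c.jac (x₁ 0, σ (y₁ 0))) - Real.log (c.jac (x₁ 1, σ (y₁ 1))))|
                ≤ Cst * θBal F.L γ b₀ p₀ J ^ 2 * Real.exp (-((θ - θ₂) * (b.src.tdist b'.src : ℝ))) := by
  intro L
  obtain ⟨c₀, hc₀, hc₀1, H1⟩ := hflat L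
  refine ⟨c₀, hc₀, hc₀1, fun cw hcw hcwle => ?_⟩
  obtain ⟨pS, H2⟩ := H1 cw hcw hcwle
  refine ⟨pS, fun b₀ p₀ hb hpS hp => ?_⟩
  obtain ⟨ε₁, hε₁, H3⟩ := H2 b₀ p₀ hb hpS hp
  refine ⟨ε₁, hε₁, fun ε₀ hε hεle => ?_⟩
  obtain ⟨γ₁, hγ₁, Cst, θ, θ₂, hC, hθ₂, hθθ, H4⟩ := H3 ε₀ hε hεle
  refine ⟨γ₁, hγ₁, Cst, θ, θ₂, hC, hθ₂, hθθ, ?_⟩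
  intro F γ hFL hγ hγle J K hJK c hCR hCJ b b' U V W Z hU hV hW hZ h1 h2 h3 h4
  obtain ⟨dZ, dV, e, σ, UZ, UV', jZ, jV, ρ, uU, uV, uW, uZ, kU, kV, kW, kZ, yU, yV, yW, yZ,
    hT, hmU, hmV, hmW, hmZ, hqU, hqV, hqW, hqZ, hDETN, hJACW⟩ :=
    H4 F γ hFL hγ hγle J K hJK c hCR hCJ b b' U V W Z hU hV hW hZ h1 h2 h3 h4
  have hk : K - J ≤ (F.P K).m + (F.P K).K := by
    show K - J ≤ F.m + K
    omega
  have hσ : Continuous σ := hT.2.2.2.1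
  -- the two edges as (E0)-inhabitants of `EdgeRows`, from (Q-TUBE) at their corners (✓p784096)
  have hE₀ := edgeRows_text_twoCorners_of_pivotAct_eq F hJK hk c (θBal F.L γ (cw * b₀) p₀ J) (minActionRegPr F J K hJK ε₀)
    (fun X => (hCR X).2.1) (fun X => (hCR X).2.2.2.2.2.2.1) (fun X => (hCR X).2.2.2.2.2.2.2.2.2.1)
    (fun X => (hCR X).2.2.2.2.2.2.2.2.2.2.2.2) hσ UV' jV b h1 hU hV hmU hmV hqU.1 hqU.2.1 hqU.2.2 hqV.1 hqV.2.1 hqV.2.2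
  have hE₁ := edgeRows_text_twoCorners_of_pivotAct_eq F hJK hk c (θBal F.L γ (cw * b₀) p₀ J) (minActionRegPr F J K hJK ε₀)
    (fun X => (hCR X).2.1) (fun X => (hCR X).2.2.2.2.2.2.1) (fun X => (hCR X).2.2.2.2.2.2.2.2.2.1)
    (fun X => (hCR X).2.2.2.2.2.2.2.2.2.2.2.2) hσ UV' jV b h4 hW hZ hmW hmZ hqW.1 hqW.2.1 hqW.2.2 hqZ.1 hqZ.2.1 hqZ.2.2
  refine ⟨dZ, dV, e, σ, UZ, UV', jZ, jV, ρ, Iio (2⁻¹ : ℝ) ∪ Ioi 2⁻¹,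
    (fun s : ℝ => if s < 2⁻¹ then U else V), (fun s : ℝ => if s < 2⁻¹ then W else Z),
    (fun s : ℝ => if s < 2⁻¹ then yU else yV), (fun s : ℝ => if s < 2⁻¹ then yW else yZ),
    hT, hE₀.1, ⟨hE₀.2.1, hE₀.2.2.1⟩, hE₀.2.2.2, hE₁.2.2.2, ?_, ?_⟩
  · -- DETN: the four named matrices are the corner matrices (§1), the `jV` arguments are the corner coordinates
    have h0 : (0 : ℝ) < 2⁻¹ := by norm_num
    have h1' : ¬ (1 : ℝ) < 2⁻¹ := by norm_num
    obtain ⟨eU0, eV1⟩ := sliceHessMatrix_twoCorner (fun p : GaugeField (F.P J) 0 (Matrix.specialUnitaryGroup (Fin 2) ℂ) × GaugeField (F.P K) 0 (Matrix.specialUnitaryGroup (Fin 2) ℂ) => c.Φ p)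
      (fun z : GaugeField (F.P K) 0 (Matrix.specialUnitaryGroup (Fin 2) ℂ) => wilsonAction4 z) σ U V yU yV
    obtain ⟨eW0, eZ1⟩ := sliceHessMatrix_twoCorner (fun p : GaugeField (F.P J) 0 (Matrix.specialUnitaryGroup (Fin 2) ℂ) × GaugeField (F.P K) 0 (Matrix.specialUnitaryGroup (Fin 2) ℂ) => c.Φ p)
      (fun z : GaugeField (F.P K) 0 (Matrix.specialUnitaryGroup (Fin 2) ℂ) => wilsonAction4 z) σ W Z yW yZ
    rw [eU0, eV1, eW0, eZ1]
    simp only [if_pos h0, if_neg h1']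
    exact hDETN
  · -- JACW: the corners
    have h0 : (0 : ℝ) < 2⁻¹ := by norm_num
    have h1' : ¬ (1 : ℝ) < 2⁻¹ := by norm_num
    simp only [if_pos h0, if_neg h1']
    exact hJACW

end Summit.QuantumFields.YangMills.Theorems.FluctuationComparisonRegPrIntLS2BetaDetRepBOfCornerLetters

end
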